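import Summits.BirchSwinnertonDyer.Rank1Residual.Additive.X3BranchDegenerateEndState
import Literature.NumberTheory.EllipticCurves.Greenberg1999.CyclotomicTorsionFinite
import HarnessLib

/-!
# X3, the DEGENERATE rows, rank `0`: the end states of `X3BranchDegenerateEndState.lean` with the
# finiteness of `W(ℚ_∞)[p^∞]` DISCHARGED by the named fact
# `Greenberg1999.finite_torsion_cyclotomicZpExtension` (Greenberg LNM 1716 §1; Imai / Ribet)
# (cell `bsd-eis`, seat `bsd-eis-x3` gen 2; route K1 `AdditiveBranchIMC` — supports only)

HONEST FRAMING (cell `bsd-eis`, `run/shared/lean/pub/bsd-eis/README.md` §4): THEOREMS ONLY; nothing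
booked. Binder diff w.r.t. `X3BranchDegenerateEndState.lean`: {`hA`} ↦ {`hTors` =
`Greenberg1999.finite_torsion_cyclotomicZpExtension`, a PUBLISHED named fact}. Remaining per-pair
displayed inputs: `hcert` (instrument) and `hn` (the residual-count evaluation).

References: [GreenbergLNM1716] §1, §3 p. 86; [Ribet1981KatzLangAppendix]; [Delbourgo1998] Prop. 4;
[Wuthrich2014] Thm. 16; [GreenbergVatsal2000] §2 Remark (2.7), (2.9); [Miller2011LMS] Def. 1.1.
-/

set_option autoImplicit false

noncomputable section

open scoped Classical AddSubgroup

namespace Summit.BirchSwinnertonDyer.Rank1Residual.Additive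

open NumberField IsDedekindDomain Field WeierstrassCurve
  Literature.NumberTheory.GaloisRepresentations
  Literature.NumberTheory.EllipticCurves
  Literature.NumberTheory.EllipticCurves.GreenbergSelmer
  Literature.NumberTheory.EllipticCurves.GreenbergVatsal2000
  Literature.NumberTheory.EllipticCurves.Rank1Residual
  Literature.NumberTheory.EllipticCurves.ModularForms
  Literature.NumberTheory.EllipticCurves.Rank1Residual.Typed
  Summit.BirchSwinnertonDyer.Rank1Residual.X1.MuLambda
  Summit.BirchSwinnertonDyer.Rank1Residual.AdditivePotMult
  Summit.BirchSwinnertonDyer.Rank1Residual.Additive.X3Branch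

variable {p : ℕ} [hp : Fact p.Prime] {W : WeierstrassCurve ℚ} [W.IsElliptic] [W.IsGloballyMinimal]

/-- **X3♯(G-ord) ∩ `I₀*` at `p = 3`, `r_an = 0`, DEGENERATE rows: Miller's `BSD(E,3)` from PUBLISHED
records ONLY + the line datum + the two per-pair instrument/evaluation inputs `hcert`, `hn`** (`hA`
discharged by `hTors`). [cite: GreenbergLNM1716, §1 and §3 p. 86] [cite: Delbourgo1998, Prop. 4 (p. 144)]
[cite: Wuthrich2014, Thm. 16 (p. 397)] [cite: Miller2011LMS, §1 and Def. 1.1] -/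
theorem ClassX3Gord.bsdp_three_rankZero_degenerate_of_facts_of_torsionFact [Fact (Nat.Prime 3)]
    {W : WeierstrassCurve ℚ} [W.IsElliptic] [W.IsGloballyMinimal]
    (hTors : Greenberg1999.finite_torsion_cyclotomicZpExtension)
    (hDelG : Delbourgo1998.prop4_rankZero_constantCoeff_eq_unit_mul_of_potGoodOrd)
    (hDel98 : Delbourgo1998.prop4_rankZero_pow_dvd_constantCoeff)
    (hGZK : rank_eq_analyticRank_of_analyticRank_le_one) (hmod : hasEntireLFunction_rat)
    (hmodD : nonempty_modularParametrizationData)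
    (hW16 : Wuthrich2014.thm16_halfEigenCharIdeal_dvd_cyclotomicPrime)
    (h23 : datumSelmer_nonPrimitive_invariants)
    (hRQ : datumSelmer_divisible_of_finite_torsionBy_of_gr_inertiaInvariants_eq_zero)
    (hGrK : Greenberg1999.imKummer_ge_strictCondition_goodOrdinary)
    (hLiftE : residualEpsilon_surjOn_of_lineEven)
    (hX : ClassX3Gord W 3) (hr : W.analyticRank = 0)
    (S₀ : Finset (HeightOneSpectrum (𝓞 ℚ))) (hne : S₀.Nonempty)
    (hS₀ : ∀ v ∈ S₀, (((3 : ℕ) : ℕ) : 𝓞 ℚ) ∉ v.asIdeal)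
    (hS : ∀ v : HeightOneSpectrum (𝓞 ℚ), v ∉ S₀ → (((3 : ℕ) : ℕ) : 𝓞 ℚ) ∉ v.asIdeal →
      W.HasGoodReductionAt v)
    (Φ₀ : AddSubgroup (W.geomTorsion ((3 : ℕ) : ℤ))) (hΦ : IsRationalLine W 3 Φ₀)
    (htriv : ∀ (σ : absoluteGaloisGroup ℚ) (P : geomTorsion W ((3 : ℕ) : ℤ)), P ∈ Φ₀ → σ • P = P)
    {n : ℕ}
    (hcert : ∀ (V : WeierstrassCurve ℚ) [V.IsElliptic] [V.IsGloballyMinimal] (C : VariableChange ℚ),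
      C • V.quadraticTwist ((-1) ^ ((3 : ℕ) / 2) * (3 : ℕ) : ℚ) = W → X3BranchUnitCoeffCertAt V 3 n)
    (hn : ∀ (κ : ZpExtension ℚ 3), κ.IsCyclotomic →
      3 ^ (n + ∑ v ∈ S₀, delta W 3 v + 1) =
        Nat.card (residualLineH1 W 3 κ S₀ Φ₀ hΦ) * Nat.card (residualQuotSelmer W 3 κ S₀ Φ₀ hΦ)) :
    BSDp W 3 :=
  ClassX3Gord.bsdp_three_rankZero_degenerate_of_facts hDelG hDel98 hGZK hmod hmodD hW16 h23 hRQ hGrK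
    hLiftE hX hr S₀ hne hS₀ hS Φ₀ hΦ htriv (fun κ hκ ↦ hTors W 3 κ hκ) hcert hn

/-- **X3♯(M) ∧ `r_an = 0`, DEGENERATE rows, every odd `p`: Miller's `BSD(E,p)` from PUBLISHED records
ONLY + the line datum + `hcert`, `hn`** (`hA` discharged by `hTors`).
[cite: GreenbergLNM1716, §1 and §3 p. 86] [cite: Delbourgo1998, Prop. 4 (p. 144)]
[cite: Wuthrich2014, Thm. 16 (p. 397)] [cite: Miller2011LMS, §1 and Def. 1.1] -/
theorem ClassX3M.bsdp_rankZero_degenerate_of_facts_of_torsionFact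
    (hTors : Greenberg1999.finite_torsion_cyclotomicZpExtension)
    (hDel98 : Delbourgo1998.prop4_rankZero_pow_dvd_constantCoeff)
    (hDelX : Delbourgo1998.prop4_rankZero_constantCoeff_eq_unit_mul_of_potMult)
    (hPal : Pal2012.thm32_sqrt_mul_realPeriodRat_twist_eq_of_prime_one_mod_four)
    (hGZK : rank_eq_analyticRank_of_analyticRank_le_one) (hmod : hasEntireLFunction_rat)
    (hmodD : nonempty_modularParametrizationData)
    (hW16 : Wuthrich2014.thm16_halfEigenCharIdeal_dvd_cyclotomicPrime)
    (h23 : datumSelmer_nonPrimitive_invariants)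
    (hRQ : datumSelmer_divisible_of_finite_torsionBy_of_gr_inertiaInvariants_eq_zero)
    (hT40 : Silverman1994_thmV53_tateUniformisation.{0})
    (hT41 : Silverman1994_thmV53_corV54_tateUniformisation.{0})
    (hLiftE : residualEpsilon_surjOn_of_lineEven)
    (hX : ClassX3M W p) (hr : W.analyticRank = 0)
    (S₀ : Finset (HeightOneSpectrum (𝓞 ℚ))) (hne : S₀.Nonempty)
    (hS₀ : ∀ v ∈ S₀, ((p : ℕ) : 𝓞 ℚ) ∉ v.asIdeal)
    (hS : ∀ v : HeightOneSpectrum (𝓞 ℚ), v ∉ S₀ → ((p : ℕ) : 𝓞 ℚ) ∉ v.asIdeal →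
      W.HasGoodReductionAt v)
    (Φ₀ : AddSubgroup (W.geomTorsion (p : ℤ))) (hΦ : IsRationalLine W p Φ₀)
    (htriv : ∀ (σ : absoluteGaloisGroup ℚ) (P : geomTorsion W (p : ℤ)), P ∈ Φ₀ → σ • P = P)
    {n : ℕ}
    (hcert : ∀ (V : WeierstrassCurve ℚ) [V.IsElliptic] [V.IsGloballyMinimal] (C : VariableChange ℚ),
      C • V.quadraticTwist ((-1) ^ (p / 2) * p : ℚ) = W → X3BranchUnitCoeffCertAt V p n)
    (hn : ∀ (κ : ZpExtension ℚ p), κ.IsCyclotomic →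
      p ^ (n + ∑ v ∈ S₀, delta W p v + 1) =
        Nat.card (residualLineH1 W p κ S₀ Φ₀ hΦ) * Nat.card (residualQuotSelmer W p κ S₀ Φ₀ hΦ)) :
    BSDp W p :=
  ClassX3M.bsdp_rankZero_degenerate_of_facts hDel98 hDelX hPal hGZK hmod hmodD hW16 h23 hRQ hT40 hT41
    hLiftE hX hr S₀ hne hS₀ hS Φ₀ hΦ htriv (fun κ hκ ↦ hTors W p κ hκ) hcert hn

end Summit.BirchSwinnertonDyer.Rank1Residual.Additive

end
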